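import Mathlib
import HarnessLib
import Summits.ValiantsHypothesis.ValiantsHypothesis.Theses.MonotoneRestoration
import Literature.Computability.AlgebraicComplexity.SymmetricCircuitPairing

/-! # Route MonotoneRestoration — crux `MonotoneRestorationQP`, line Sketch, stub E2
(stmt-ValiantsHypothesis-15886)

**Pairing of symmetric circuits.** Two `Γ`-symmetric Dawar–Wilsenach labelled arithmetic
circuits over the same constants `K` and variables `X`, with outputs indexed by `Γ`-sets `Y₁`,
`Y₂`, merge into ONE `Γ`-symmetric circuit with outputs indexed by `Y₁ ⊕ Y₂` computing both
output families, on at most `|G₁| + |G₂|` gates.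

Proof: the universe-`0` instance of the tree lemma
`LabelledArithCircuit.IsSymmetric.exists_pairing`
(`Literature/Computability/AlgebraicComplexity/SymmetricCircuitPairing.lean`): gate set
`G₁ ⊕ G₂`, a gate of the second circuit whose input label already occurs in the first circuit
becomes a unary addition gate over its twin, automorphism pairs act as `π₁ ⊕ π₂`.
-/

noncomputable section

-- `Summit.ValiantsHypothesis.ValiantsHypothesis.…` is the tree's mandated namespace (Sub = Summit).
set_option linter.dupNamespace false

namespace Summit.ValiantsHypothesis.ValiantsHypothesis.Theorems

open Literature.Computability.AlgebraicComplexity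

/-- **E2 — pairing of symmetric circuits** (crux `MonotoneRestorationQP`, line Sketch; registered
stub `stub_symmetricPairing`): two `Γ`-symmetric labelled circuits over `K`, `X` with outputs
indexed by `Y₁`, `Y₂` merge into one `Γ`-symmetric circuit with outputs `Y₁ ⊕ Y₂` computing both
families, on at most `|G₁| + |G₂|` gates. Instance of
`LabelledArithCircuit.IsSymmetric.exists_pairing`. -/
theorem stub_symmetricPairing {K X Y₁ Y₂ Γ G₁ G₂ : Type} [CommSemiring K] [Group Γ]
    [MulAction Γ X] [MulAction Γ Y₁] [MulAction Γ Y₂] [Fintype G₁] [Fintype G₂]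
    (C₁ : LabelledArithCircuit K X Y₁ G₁) (C₂ : LabelledArithCircuit K X Y₂ G₂)
    (h₁ : C₁.IsSymmetric Γ) (h₂ : C₂.IsSymmetric Γ) :
    ∃ (G : Type) (_ : Fintype G) (C : LabelledArithCircuit K X (Y₁ ⊕ Y₂) G),
      C.IsSymmetric Γ ∧
      (∀ y, C.eval (C.output (Sum.inl y)) = C₁.eval (C₁.output y)) ∧
      (∀ y, C.eval (C.output (Sum.inr y)) = C₂.eval (C₂.output y)) ∧
      Fintype.card G ≤ Fintype.card G₁ + Fintype.card G₂ :=
  h₁.exists_pairing h₂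

end Summit.ValiantsHypothesis.ValiantsHypothesis.Theorems

end
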